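import Literature.MathematicalPhysics.QuantumFieldTheory.Balaban1983to89.B9Eq3101ConjugationLetters
import Literature.MathematicalPhysics.QuantumFieldTheory.Balaban1983to89.B9Eq384RemainderLetters

/-!
# `Balaban1983to89.B9Eq3101ConjugationLettersChain` — T. Bałaban, *Propagators for lattice gauge theories in a background field*, Commun. Math.
# Phys. **99** (1985) 389–434 [Balaban1985BackgroundPropagators] (3.49) p. 399 with (3.101)–(3.103) p. 414: **THE (I4) CONJUGATION LETTERS AT THE
# NE9 CHAIN's INSTANCE** — for ANY pair of linear maps ACTING as the multiplications `e^{κχ}` (outside) and `e^{−κχ}` (inside) on the weighted `L²`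
# carriers: `‖S·D_U(S⁻¹f) − D_Uf‖ ≤ 2|κ|ℓ·M_φM_φ′·√d·‖f‖` for the chain's `D_U = covDerivL2K ℂ c₀ η⁻¹ (adTransportW φ U)` at EVERY unit-bounded background,
# and `‖S′·Q̃′(U)(S⁻¹λ) − Q̃′(U)λ‖ ≤ 2|κ|ℓ′·M_A·√(c₁∕(c₀L^d))·‖λ‖` for the chain's `c₁`-weighted one-step averaging `Q̃′(U) = (WL2.linearEquiv … c₁)⁻¹ ∘ QprimeW`
# (`= 2|κ|ℓ′M_A‖λ‖` at the point `c₁ = L^d c₀`) — route R2′ STEP B8′ S-P5(b), input (I4), in the dress the S-P5(b) porter consumes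

statement-level skeleton of published theorems with citation tags; proofs where landed; nothing here is a claim about the Yang–Mills mass gap

CITATION HEADER (lean-in-tree rule).  Audit cell `pub-balaban`, sub-cell `t4`, BINDER row NE9; filed by NE9 formalisation-swarm leaf prover 05
(`b2b-balaban-t4-ne9-formalise-leaf-05`, gen 72) as the SEQUEL of `B9Eq3101ConjugationLetters` (this lineage; the lattice port of t4-ne9-idea-1 gen 88's
kernel `t4/ideate/NE9/lens1-NE9ConjugatedLettersEtaFree.lean` v1.1 6f63eddbc7a13ed9 — CREDIT for every idea there), for `t4/ROUTES-NE9.md` v13.26 §L1.2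
ADDENDUM (ii) «DICTIONARY FOR THE S-P5(b) PORTER» (`S = e^{κχ}`, `Sinv = e^{−κχ}` «as multiplication operators»; `δ± ≤ s_A|κ|`).  No new printed locus:
[Balaban1985BackgroundPropagators] p. 399 (3.49), p. 414 (3.101)–(3.103) as quoted in the parent file's header; (3.19) p. 393 (`Q′`), (3.3) pp. 390–391
(`D_U`), (3.11) p. 392 (the weighted pairings), p. 390 (the transporter `R(U(b))X = U(b)XU(b)⁻¹`).

WHY.  The S-P5(b) porter will realise the conjugation `S = e^{κχ}` as continuous linear maps of its own making (a `κ`-holomorphic family, to feed the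
Cauchy commutator step); this file states the (I4) letters for ANY linear maps that ACT pointwise as those multiplications (hypotheses `hS`, `hSinv`
below — two `rfl`-dischargeable lines for a diagonal operator), so that no definition is fixed here (FREEZE (0): no new definition modules) and the
porter's operators plug in by two pointwise identities.  The background enters through `M_T = M_φM_φ′` (EVERY `U` with `U(b) ∈ U1` — no window) and the
contour-transport bound `M_A` (from `ε`-closeness, parent §4).

WHAT IS PROVED (sorry-free; proof lane — no `def`; [folklore] bookkeeping over the parent file; nothing of [B9] asserted).
* §1 `norm_adTransportW_le` (`U(b) ∈ U1 ⇒ ‖R(U(b))w‖ ≤ M_φM_φ′‖w‖` — the transporter letter `M_T` at the chain's `adTransportW φ U`, NO smallness).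
* §2 `eq_symm_of_pointwise` (a linear map acting pointwise as a multiplication IS that multiplication read through `WL2.equiv`),
  **`norm_mulOp_covDerivL2K_sub_le`** (abstract `S`, `S⁻¹` acting as `e^{κχ(b₋)}`, `e^{−κχ(x)}`: `‖S(D(S⁻¹f)) − Df‖ ≤ 2‖c‖‖κ‖θM_T√d‖f‖`),
  **`norm_mulOp_covDerivL2K_adTransportW_sub_le`** (the chain's `D_U`, `c = η⁻¹`, bond increments `≤ ℓη`: `≤ 2‖κ‖ℓ·M_φM_φ′·√d·‖f‖` for EVERY `U(b) ∈ U1`).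
* §3 `QprimeW_eq_QprimeLin` (unfolding), **`norm_mulOp_Qtilde_sub_le`** (abstract `S′` on the `c₁`-carrier of the coarse torus, `S⁻¹` on the fine `c₀`-carrier:
  `‖S′(Q̃′(S⁻¹λ)) − Q̃′λ‖ ≤ 2‖κ‖ℓ′M_A·√(c₁(c₀L^d)⁻¹)·‖λ‖`), **`norm_mulOp_Qtilde_sub_le_diagonal`** (`c₁ = L^d c₀`: `≤ 2‖κ‖ℓ′M_A‖λ‖`),
  **`norm_mulOp_Qtilde_adTransportW_sub_le_diagonal`** (`M_A := (1 + 2M_φM_φ′ε_U)^{d(L−1)}` PRODUCED from `‖U(b) − 1‖ ≤ ε_U`, `U(b) ∈ U1`).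
HONEST SCOPE.  Letters only, as in the parent: NO decay, NO commutator ∕ Cauchy step, NO projection; the cutoff increments `θ = ℓη` ∕ `ℓ′` DISPLAYED; the
adjoint letters by `‖A†‖ = ‖A‖` at `−κ̄` (words); ONE input of one sub-step of a route step, NOT NE9 (cell pub-balaban: NE9 NOT PRINTED ∕ NOT PROVED; «NE9 ⇐ the
named binders»; spine PROVED 0∕9; rung (B)+1 on a finite T⁴ — NOT infinite volume, NOT mass gap, NOT Clay; HONEST DEPENDENCY: continuum YM on T⁴ ⇐ BetaPertH ∧
nine spine estimates (0/9 proved); BetaPertH ⇐ (D1) ∧ (D4) ∧ CAP+tail; G-an2-4 gates asym, D1 and NE2/3/4).  NEW file; nothing modified.  Net new unproved facts: 0.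
-/

noncomputable section

open scoped InnerProductSpace
open Finset

namespace Literature.MathematicalPhysics.QuantumFieldTheory.Balaban1983to89.B9Eq3101ConjugationLettersChain

open B4Sect5Torus (TSite)
open B9SectCLatticeCarrier (Bond bpos btgt)
open B9Eq311L2Pairing (WL2)
open B11Eq103H1Complex (SiteL2K BondL2K covDerivL2K)
open B7Prop1Explicit (U1)
open B9Eq310HessianOperator (adTransportW adTransportW_apply)
open B9Eq323Ker (pathTr)
open B9Eq319QprimeTorus (fineP centre contour stepTransport QprimeLin)
open B9Eq326OperatorAssembly (QprimeW)
open B9Eq384RemainderLetters (norm_adTransportW_sub_le)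
open B9Eq3101ConjugationLetters (norm_conjExp_covDerivL2K_sub_le sum_norm_sq_conjExp_QprimeLin_sub_le norm_pathTr_contour_le)

/-! ## §1 The transporter letter `M_T = M_φM_φ′` at the chain's `adTransportW φ U` -/

section Transporter

variable {d : ℕ} {Pd : Fin d → ℕ} {𝔸 : Type*} [NormedRing 𝔸] [NormedAlgebra ℂ 𝔸] [NormOneClass 𝔸]
  {W : Type*} [NormedAddCommGroup W] [InnerProductSpace ℂ W] (φ : W ≃ₗ[ℂ] 𝔸) {Mφ Mφ' : ℝ}
  (hφ : ∀ w, ‖φ w‖ ≤ Mφ * ‖w‖) (hφ' : ∀ X, ‖φ.symm X‖ ≤ Mφ' * ‖X‖) (hMφ' : 0 ≤ Mφ')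

include hφ hφ' hMφ' in
/-- **`‖R(U(b))w‖ ≤ M_φM_φ′‖w‖` for EVERY bond variable in the unit balls** (`‖U(b)‖ ≤ 1`, `‖U(b)⁻¹‖ ≤ 1`): the transporter `w ↦ φ⁻¹(U(b)·φw·U(b)⁻¹)` is
bounded by the two norming constants alone — NO smallness of the background. [cite: Balaban1985BackgroundPropagators, p.390, (3.35) p.397] -/
theorem norm_adTransportW_le (U : Bond d Pd → 𝔸ˣ) (b : Bond d Pd) (hU : U b ∈ U1 𝔸) (w : W) : ‖adTransportW φ U b w‖ ≤ Mφ * Mφ' * ‖w‖ := by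
  have h1 : ‖(U b : 𝔸)‖ ≤ 1 := (B7Prop1Explicit.mem_U1.1 hU).1
  have h2 : ‖(((U b)⁻¹ : 𝔸ˣ) : 𝔸)‖ ≤ 1 := (B7Prop1Explicit.mem_U1.1 hU).2
  have hX : ‖φ w‖ ≤ Mφ * ‖w‖ := hφ w
  have hMφw : 0 ≤ Mφ * ‖w‖ := (norm_nonneg _).trans hX
  rw [adTransportW_apply]
  calc ‖φ.symm ((U b : 𝔸) * φ w * (((U b)⁻¹ : 𝔸ˣ) : 𝔸))‖ ≤ Mφ' * ‖(U b : 𝔸) * φ w * (((U b)⁻¹ : 𝔸ˣ) : 𝔸)‖ := hφ' _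
    _ ≤ Mφ' * (1 * (Mφ * ‖w‖) * 1) := by
        refine mul_le_mul_of_nonneg_left ?_ hMφ'
        calc ‖(U b : 𝔸) * φ w * (((U b)⁻¹ : 𝔸ˣ) : 𝔸)‖ ≤ ‖(U b : 𝔸) * φ w‖ * ‖(((U b)⁻¹ : 𝔸ˣ) : 𝔸)‖ := norm_mul_le _ _
          _ ≤ (‖(U b : 𝔸)‖ * ‖φ w‖) * ‖(((U b)⁻¹ : 𝔸ˣ) : 𝔸)‖ := mul_le_mul_of_nonneg_right (norm_mul_le _ _) (norm_nonneg _)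
          _ ≤ (1 * (Mφ * ‖w‖)) * 1 :=
              mul_le_mul (mul_le_mul h1 hX (norm_nonneg _) zero_le_one) h2 (norm_nonneg _) (by positivity)
    _ = Mφ * Mφ' * ‖w‖ := by ring

end Transporter

/-! ## §2 The bond letter for abstract multiplication operators, and at the chain's `D_U` -/

section BondOps

variable {d : ℕ} {Pd : Fin d → ℕ} {V : Type*} [NormedAddCommGroup V] [InnerProductSpace ℂ V] {c₀ : ℝ} [Fact (0 < c₀)]

/-- A map of the weighted carrier that ACTS pointwise as multiplication by a scalar function IS that multiplication read through the identification
`WL2.equiv` (the carrier is a type synonym of the functions). [folklore] [cite: Balaban1985BackgroundPropagators, (3.11) p.392] -/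
theorem eq_symm_of_pointwise {X : Type*} [Fintype X] {w : X → ℝ} (S : WL2 ℂ w V → WL2 ℂ w V) (σ : X → ℂ)
    (hS : ∀ (g : WL2 ℂ w V) (x : X), WL2.equiv ℂ w V (S g) x = σ x • WL2.equiv ℂ w V g x) (g : WL2 ℂ w V) :
    S g = (WL2.equiv ℂ w V).symm fun x => σ x • WL2.equiv ℂ w V g x :=
  (WL2.equiv ℂ w V).injective (funext fun x => by rw [hS]; rfl)

/-- **THE BOND LETTER FOR ABSTRACT MULTIPLICATION OPERATORS.** For ANY maps `S` of the bond carrier and `S⁻¹` of the site carrier acting pointwise as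
`e^{κχ(b₋)}` resp. `e^{−κχ(x)}` (hypotheses `hS`, `hSinv`), transporters `‖R(b)v‖ ≤ M_T‖v‖`, bond increments `|χ(b₋) − χ(b₊)| ≤ θ` (`0 ≤ θ`) and the
window `‖κ‖θ ≤ 1`: `‖S(D(S⁻¹f)) − Df‖ ≤ 2‖c‖‖κ‖θ·M_T·√d·‖f‖`. [folklore] [cite: Balaban1985BackgroundPropagators, (3.49) p.399, (3.101)–(3.103) p.414] -/
theorem norm_mulOp_covDerivL2K_sub_le {θ MT : ℝ} (hθ : 0 ≤ θ) (hMT : 0 ≤ MT) {R : Bond d Pd → V →ₗ[ℂ] V} (hR : ∀ b v, ‖R b v‖ ≤ MT * ‖v‖)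
    {κ : ℂ} {χ : TSite d Pd → ℝ} (hχ : ∀ b : Bond d Pd, |χ (bpos b) - χ (btgt b)| ≤ θ) (hwin : ‖κ‖ * θ ≤ 1) (c : ℂ)
    (S : BondL2K ℂ d Pd c₀ V → BondL2K ℂ d Pd c₀ V)
    (hS : ∀ (g : BondL2K ℂ d Pd c₀ V) (b : Bond d Pd),
      WL2.equiv ℂ (fun _ : Bond d Pd => c₀) V (S g) b = Complex.exp (κ * (χ (bpos b) : ℂ)) • WL2.equiv ℂ (fun _ : Bond d Pd => c₀) V g b)
    (Sinv : SiteL2K ℂ d Pd c₀ V → SiteL2K ℂ d Pd c₀ V)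
    (hSinv : ∀ (f : SiteL2K ℂ d Pd c₀ V) (x : TSite d Pd),
      WL2.equiv ℂ (fun _ : TSite d Pd => c₀) V (Sinv f) x = Complex.exp (-(κ * (χ x : ℂ))) • WL2.equiv ℂ (fun _ : TSite d Pd => c₀) V f x)
    (f : SiteL2K ℂ d Pd c₀ V) :
    ‖S (covDerivL2K ℂ c₀ c R (Sinv f)) - covDerivL2K ℂ c₀ c R f‖ ≤ 2 * ‖c‖ * ‖κ‖ * θ * MT * Real.sqrt d * ‖f‖ := by
  rw [eq_symm_of_pointwise S _ hS, eq_symm_of_pointwise Sinv _ hSinv]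
  exact norm_conjExp_covDerivL2K_sub_le hθ hMT hR hχ hwin c f

variable {𝔸 : Type*} [NormedRing 𝔸] [NormedAlgebra ℂ 𝔸] [NormOneClass 𝔸] (φ : V ≃ₗ[ℂ] 𝔸) {Mφ Mφ' : ℝ}
  (hφ : ∀ w, ‖φ w‖ ≤ Mφ * ‖w‖) (hφ' : ∀ X, ‖φ.symm X‖ ≤ Mφ' * ‖X‖) (hMφ : 0 ≤ Mφ) (hMφ' : 0 ≤ Mφ')

include hφ hφ' hMφ hMφ' in
/-- **THE (I4) LETTER `s_D` AT THE CHAIN's `D_U`** (`covDerivL2K ℂ c₀ η⁻¹ (adTransportW φ U)`, EVERY background with `U(b) ∈ U1` — no window in `U`):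
for maps `S`, `S⁻¹` acting as `e^{κχ(b₋)}`, `e^{−κχ(x)}`, bond increments `|χ(b₋) − χ(b₊)| ≤ ℓη` (`0 ≤ ℓ`, `0 < η`) and the window `‖κ‖ℓη ≤ 1`:
`‖S(D_U(S⁻¹f)) − D_Uf‖ ≤ 2‖κ‖ℓ·M_φM_φ′·√d·‖f‖` — NO `η`, NO volume. [folklore] [cite: Balaban1985BackgroundPropagators, (3.49) p.399, (3.101)–(3.103) p.414, (3.3) pp.390–391] -/
theorem norm_mulOp_covDerivL2K_adTransportW_sub_le {η ℓ : ℝ} (hη : 0 < η) (hℓ : 0 ≤ ℓ) (U : Bond d Pd → 𝔸ˣ) (hU : ∀ b, U b ∈ U1 𝔸)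
    {κ : ℂ} {χ : TSite d Pd → ℝ} (hχ : ∀ b : Bond d Pd, |χ (bpos b) - χ (btgt b)| ≤ ℓ * η) (hwin : ‖κ‖ * ℓ * η ≤ 1)
    (S : BondL2K ℂ d Pd c₀ V → BondL2K ℂ d Pd c₀ V)
    (hS : ∀ (g : BondL2K ℂ d Pd c₀ V) (b : Bond d Pd),
      WL2.equiv ℂ (fun _ : Bond d Pd => c₀) V (S g) b = Complex.exp (κ * (χ (bpos b) : ℂ)) • WL2.equiv ℂ (fun _ : Bond d Pd => c₀) V g b)
    (Sinv : SiteL2K ℂ d Pd c₀ V → SiteL2K ℂ d Pd c₀ V)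
    (hSinv : ∀ (f : SiteL2K ℂ d Pd c₀ V) (x : TSite d Pd),
      WL2.equiv ℂ (fun _ : TSite d Pd => c₀) V (Sinv f) x = Complex.exp (-(κ * (χ x : ℂ))) • WL2.equiv ℂ (fun _ : TSite d Pd => c₀) V f x)
    (f : SiteL2K ℂ d Pd c₀ V) :
    ‖S (covDerivL2K ℂ c₀ ((η : ℂ))⁻¹ (adTransportW φ U) (Sinv f)) - covDerivL2K ℂ c₀ ((η : ℂ))⁻¹ (adTransportW φ U) f‖ ≤
      2 * ‖κ‖ * ℓ * (Mφ * Mφ') * Real.sqrt d * ‖f‖ := by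
  have hwin' : ‖κ‖ * (ℓ * η) ≤ 1 := by simpa [mul_assoc] using hwin
  have hR : ∀ (b : Bond d Pd) (v : V), ‖adTransportW φ U b v‖ ≤ Mφ * Mφ' * ‖v‖ := fun b v => norm_adTransportW_le φ hφ hφ' hMφ' U b (hU b) v
  refine (norm_mulOp_covDerivL2K_sub_le (by positivity) (by positivity) hR hχ hwin' _ S hS Sinv hSinv f).trans_eq ?_
  rw [norm_inv, Complex.norm_real, Real.norm_eq_abs, abs_of_pos hη]
  field_simp

end BondOps

/-! ## §3 The block-averaging letter for the chain's `c₁`-weighted `Q̃′(U)` -/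

section BlockOps

variable {d : ℕ} (L : ℕ) [NeZero L] (m : Fin d → ℕ) {𝔸 : Type*} [NormedRing 𝔸] [NormedAlgebra ℂ 𝔸]
  {W : Type*} [NormedAddCommGroup W] [InnerProductSpace ℂ W] (φ : W ≃ₗ[ℂ] 𝔸) {c₀ c₁ : ℝ} (U : Bond d (fineP L m) → 𝔸ˣ)

/-- Unfolding: `QprimeW L m φ U λ = QprimeLin L m (adTransportW φ U) λ` on the underlying function. [cite: Balaban1985BackgroundPropagators, (3.19) p.393] -/
theorem QprimeW_eq_QprimeLin (lam : SiteL2K ℂ d (fineP L m) c₀ W) :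
    QprimeW L m φ U lam = QprimeLin L m (adTransportW φ U) (WL2.equiv ℂ (fun _ : TSite d (fineP L m) => c₀) W lam) := rfl

variable [Fact (0 < c₀)] [Fact (0 < c₁)]

/-- **THE BLOCK-AVERAGING LETTER FOR ABSTRACT MULTIPLICATION OPERATORS on the chain's carriers.** For the `c₁`-weighted one-step averaging
`Q̃′(U) = (WL2.linearEquiv … c₁)⁻¹ ∘ QprimeW L m φ U`, ANY maps `S′` (coarse carrier) and `S⁻¹` (fine carrier) acting pointwise as `e^{κχ′(y)}` resp.
`e^{−κχ(x)}`, contour transports bounded by `M_A` (`0 ≤ M_A`), block increments `|χ′(y) − χ(x)| ≤ ℓ′` on `x ∈ B(y)` and the window `‖κ‖ℓ′ ≤ 1`: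
`‖S′(Q̃′(S⁻¹λ)) − Q̃′λ‖ ≤ 2‖κ‖ℓ′M_A·√(c₁(c₀L^d)⁻¹)·‖λ‖`. [folklore] [cite: Balaban1985BackgroundPropagators, (3.19) p.393, (3.101)–(3.103) p.414, (3.11) p.392] -/
theorem norm_mulOp_Qtilde_sub_le {ℓ' MA : ℝ} (hℓ' : 0 ≤ ℓ') (hMA : 0 ≤ MA)
    (hA : ∀ (y : TSite d m), ∀ x ∈ B9Eq319QprimeTorus.blockOf L m y, ∀ v : W,
      ‖pathTr (stepTransport L m fun b => (adTransportW φ U b).restrictScalars ℝ) (centre L m y :: contour L m x) v‖ ≤ MA * ‖v‖)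
    {κ : ℂ} {χ : TSite d (fineP L m) → ℝ} {χ' : TSite d m → ℝ}
    (hχ : ∀ (y : TSite d m), ∀ x ∈ B9Eq319QprimeTorus.blockOf L m y, |χ' y - χ x| ≤ ℓ') (hwin : ‖κ‖ * ℓ' ≤ 1)
    (S' : WL2 ℂ (fun _ : TSite d m => c₁) W → WL2 ℂ (fun _ : TSite d m => c₁) W)
    (hS' : ∀ (g : WL2 ℂ (fun _ : TSite d m => c₁) W) (y : TSite d m),
      WL2.equiv ℂ (fun _ : TSite d m => c₁) W (S' g) y = Complex.exp (κ * (χ' y : ℂ)) • WL2.equiv ℂ (fun _ : TSite d m => c₁) W g y)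
    (Sinv : SiteL2K ℂ d (fineP L m) c₀ W → SiteL2K ℂ d (fineP L m) c₀ W)
    (hSinv : ∀ (f : SiteL2K ℂ d (fineP L m) c₀ W) (x : TSite d (fineP L m)),
      WL2.equiv ℂ (fun _ : TSite d (fineP L m) => c₀) W (Sinv f) x =
        Complex.exp (-(κ * (χ x : ℂ))) • WL2.equiv ℂ (fun _ : TSite d (fineP L m) => c₀) W f x)
    (lam : SiteL2K ℂ d (fineP L m) c₀ W) :
    ‖S' ((WL2.linearEquiv ℂ ℂ (fun _ : TSite d m => c₁)).symm (QprimeW L m φ U (Sinv lam))) -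
        (WL2.linearEquiv ℂ ℂ (fun _ : TSite d m => c₁)).symm (QprimeW L m φ U lam)‖ ≤
      2 * ‖κ‖ * ℓ' * MA * Real.sqrt (c₁ * (c₀ * (L : ℝ) ^ d)⁻¹) * ‖lam‖ := by
  have hc₀ : 0 < c₀ := Fact.out
  have hc₁ : 0 < c₁ := Fact.out
  have hL : (0 : ℝ) < (L : ℝ) ^ d := by
    have : (0 : ℝ) < L := by exact_mod_cast Nat.pos_of_ne_zero (NeZero.ne L)
    positivity
  set K : ℝ := 2 * ‖κ‖ * ℓ' * MA with hK
  have hK0 : 0 ≤ K := by positivity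
  set l : TSite d (fineP L m) → W := WL2.equiv ℂ (fun _ : TSite d (fineP L m) => c₀) W lam with hl
  have hsum := sum_norm_sq_conjExp_QprimeLin_sub_le L m (adTransportW φ U) hA hχ hwin l
  -- the underlying functions of the two members
  have e : ∀ y : TSite d m,
      WL2.equiv ℂ (fun _ : TSite d m => c₁) W
          (S' ((WL2.linearEquiv ℂ ℂ (fun _ : TSite d m => c₁)).symm (QprimeW L m φ U (Sinv lam))) -
            (WL2.linearEquiv ℂ ℂ (fun _ : TSite d m => c₁)).symm (QprimeW L m φ U lam)) y =
        Complex.exp (κ * (χ' y : ℂ)) • QprimeLin L m (adTransportW φ U) (fun x => Complex.exp (-(κ * (χ x : ℂ))) • l x) y -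
          QprimeLin L m (adTransportW φ U) l y := by
    intro y
    rw [B9Eq311L2Pairing.WL2.equiv_sub, Pi.sub_apply, hS', eq_symm_of_pointwise Sinv _ hSinv lam]
    rfl
  have hsq : ‖S' ((WL2.linearEquiv ℂ ℂ (fun _ : TSite d m => c₁)).symm (QprimeW L m φ U (Sinv lam))) -
        (WL2.linearEquiv ℂ ℂ (fun _ : TSite d m => c₁)).symm (QprimeW L m φ U lam)‖ ^ 2 ≤
      (K * Real.sqrt (c₁ * (c₀ * (L : ℝ) ^ d)⁻¹) * ‖lam‖) ^ 2 := by
    rw [WL2.norm_sq, mul_pow, mul_pow, Real.sq_sqrt (by positivity), WL2.norm_sq lam]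
    simp only [e]
    rw [← mul_sum, ← mul_sum]
    calc c₁ * ∑ y, ‖Complex.exp (κ * (χ' y : ℂ)) • QprimeLin L m (adTransportW φ U) (fun x => Complex.exp (-(κ * (χ x : ℂ))) • l x) y -
            QprimeLin L m (adTransportW φ U) l y‖ ^ 2
        ≤ c₁ * (K ^ 2 * (((L : ℝ) ^ d)⁻¹ * ∑ x, ‖l x‖ ^ 2)) := mul_le_mul_of_nonneg_left hsum hc₁.le
      _ = K ^ 2 * (c₁ * (c₀ * (L : ℝ) ^ d)⁻¹) * (c₀ * ∑ x, ‖l x‖ ^ 2) := by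
          field_simp
  have hR0 : 0 ≤ K * Real.sqrt (c₁ * (c₀ * (L : ℝ) ^ d)⁻¹) * ‖lam‖ := by positivity
  calc _ ≤ K * Real.sqrt (c₁ * (c₀ * (L : ℝ) ^ d)⁻¹) * ‖lam‖ := (pow_le_pow_iff_left₀ (norm_nonneg _) hR0 two_ne_zero).1 hsq
    _ = 2 * ‖κ‖ * ℓ' * MA * Real.sqrt (c₁ * (c₀ * (L : ℝ) ^ d)⁻¹) * ‖lam‖ := by rw [hK]

/-- **THE (I4) LETTER `s_{Q′}` AT THE POINT `c₁ = L^d·c₀` (route R2′'s diagonal `ηL = 1`):** `‖S′(Q̃′(S⁻¹λ)) − Q̃′λ‖ ≤ 2‖κ‖ℓ′·M_A·‖λ‖` — no `η`, no `L`,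
no volume, the background only through `M_A`. [folklore] [cite: Balaban1985BackgroundPropagators, (3.19) p.393, (3.101)–(3.103) p.414, (3.11) p.392] -/
theorem norm_mulOp_Qtilde_sub_le_diagonal {ℓ' MA : ℝ} (hℓ' : 0 ≤ ℓ') (hMA : 0 ≤ MA) (hc : c₁ = (L : ℝ) ^ d * c₀)
    (hA : ∀ (y : TSite d m), ∀ x ∈ B9Eq319QprimeTorus.blockOf L m y, ∀ v : W,
      ‖pathTr (stepTransport L m fun b => (adTransportW φ U b).restrictScalars ℝ) (centre L m y :: contour L m x) v‖ ≤ MA * ‖v‖)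
    {κ : ℂ} {χ : TSite d (fineP L m) → ℝ} {χ' : TSite d m → ℝ}
    (hχ : ∀ (y : TSite d m), ∀ x ∈ B9Eq319QprimeTorus.blockOf L m y, |χ' y - χ x| ≤ ℓ') (hwin : ‖κ‖ * ℓ' ≤ 1)
    (S' : WL2 ℂ (fun _ : TSite d m => c₁) W → WL2 ℂ (fun _ : TSite d m => c₁) W)
    (hS' : ∀ (g : WL2 ℂ (fun _ : TSite d m => c₁) W) (y : TSite d m),
      WL2.equiv ℂ (fun _ : TSite d m => c₁) W (S' g) y = Complex.exp (κ * (χ' y : ℂ)) • WL2.equiv ℂ (fun _ : TSite d m => c₁) W g y)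
    (Sinv : SiteL2K ℂ d (fineP L m) c₀ W → SiteL2K ℂ d (fineP L m) c₀ W)
    (hSinv : ∀ (f : SiteL2K ℂ d (fineP L m) c₀ W) (x : TSite d (fineP L m)),
      WL2.equiv ℂ (fun _ : TSite d (fineP L m) => c₀) W (Sinv f) x =
        Complex.exp (-(κ * (χ x : ℂ))) • WL2.equiv ℂ (fun _ : TSite d (fineP L m) => c₀) W f x)
    (lam : SiteL2K ℂ d (fineP L m) c₀ W) :
    ‖S' ((WL2.linearEquiv ℂ ℂ (fun _ : TSite d m => c₁)).symm (QprimeW L m φ U (Sinv lam))) -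
        (WL2.linearEquiv ℂ ℂ (fun _ : TSite d m => c₁)).symm (QprimeW L m φ U lam)‖ ≤ 2 * ‖κ‖ * ℓ' * MA * ‖lam‖ := by
  have hc₀ : 0 < c₀ := Fact.out
  have hL : (0 : ℝ) < (L : ℝ) ^ d := by
    have : (0 : ℝ) < L := by exact_mod_cast Nat.pos_of_ne_zero (NeZero.ne L)
    positivity
  have h1 : c₁ * (c₀ * (L : ℝ) ^ d)⁻¹ = 1 := by rw [hc]; field_simp
  have h := norm_mulOp_Qtilde_sub_le L m φ U hℓ' hMA hA hχ hwin S' hS' Sinv hSinv lam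
  rwa [h1, Real.sqrt_one, mul_one] at h

variable [NormOneClass 𝔸] {Mφ Mφ' : ℝ} (hφ : ∀ w, ‖φ w‖ ≤ Mφ * ‖w‖) (hφ' : ∀ X, ‖φ.symm X‖ ≤ Mφ' * ‖X‖) (hMφ : 0 ≤ Mφ) (hMφ' : 0 ≤ Mφ')

include hφ hφ' hMφ hMφ' in
/-- **THE (I4) LETTER `s_{Q′}` WITH THE TRANSPORT LETTER PRODUCED:** for a background with `U(b) ∈ U1`, `‖U(b) − 1‖ ≤ ε_U` on every
bond of the fine torus (`0 ≤ ε_U`), `M_A := (1 + 2M_φM_φ′ε_U)^{d(L−1)}` inhabits the contour-transport slot (parent §4 `norm_pathTr_contour_le` with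
`B9Eq384RemainderLetters.norm_adTransportW_sub_le`), so at `c₁ = L^d·c₀`: `‖S′(Q̃′(U)(S⁻¹λ)) − Q̃′(U)λ‖ ≤ 2‖κ‖ℓ′·(1 + 2M_φM_φ′ε_U)^{d(L−1)}·‖λ‖`.
[folklore] [cite: Balaban1985BackgroundPropagators, (3.19) p.393, (3.101)–(3.103) p.414, (3.65) p.403, (3.70) p.404] -/
theorem norm_mulOp_Qtilde_adTransportW_sub_le_diagonal {ℓ' εU : ℝ} (hℓ' : 0 ≤ ℓ') (hεU : 0 ≤ εU) (hc : c₁ = (L : ℝ) ^ d * c₀)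
    (hU : ∀ b, U b ∈ U1 𝔸) (hUε : ∀ b, ‖(U b : 𝔸) - 1‖ ≤ εU)
    {κ : ℂ} {χ : TSite d (fineP L m) → ℝ} {χ' : TSite d m → ℝ}
    (hχ : ∀ (y : TSite d m), ∀ x ∈ B9Eq319QprimeTorus.blockOf L m y, |χ' y - χ x| ≤ ℓ') (hwin : ‖κ‖ * ℓ' ≤ 1)
    (S' : WL2 ℂ (fun _ : TSite d m => c₁) W → WL2 ℂ (fun _ : TSite d m => c₁) W)
    (hS' : ∀ (g : WL2 ℂ (fun _ : TSite d m => c₁) W) (y : TSite d m),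
      WL2.equiv ℂ (fun _ : TSite d m => c₁) W (S' g) y = Complex.exp (κ * (χ' y : ℂ)) • WL2.equiv ℂ (fun _ : TSite d m => c₁) W g y)
    (Sinv : SiteL2K ℂ d (fineP L m) c₀ W → SiteL2K ℂ d (fineP L m) c₀ W)
    (hSinv : ∀ (f : SiteL2K ℂ d (fineP L m) c₀ W) (x : TSite d (fineP L m)),
      WL2.equiv ℂ (fun _ : TSite d (fineP L m) => c₀) W (Sinv f) x =
        Complex.exp (-(κ * (χ x : ℂ))) • WL2.equiv ℂ (fun _ : TSite d (fineP L m) => c₀) W f x)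
    (lam : SiteL2K ℂ d (fineP L m) c₀ W) :
    ‖S' ((WL2.linearEquiv ℂ ℂ (fun _ : TSite d m => c₁)).symm (QprimeW L m φ U (Sinv lam))) -
        (WL2.linearEquiv ℂ ℂ (fun _ : TSite d m => c₁)).symm (QprimeW L m φ U lam)‖ ≤
      2 * ‖κ‖ * ℓ' * (1 + 2 * Mφ * Mφ' * εU) ^ (d * (L - 1)) * ‖lam‖ := by
  have hε : 0 ≤ 2 * Mφ * Mφ' * εU := by positivity
  have hR : ∀ b (w : W), ‖adTransportW φ U b w - w‖ ≤ 2 * Mφ * Mφ' * εU * ‖w‖ := fun b w =>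
    norm_adTransportW_sub_le φ hφ hφ' hMφ' U b (hU b) (hUε b) w
  have hA := fun (y : TSite d m) (x : TSite d (fineP L m)) (_ : x ∈ B9Eq319QprimeTorus.blockOf L m y) (v : W) =>
    norm_pathTr_contour_le L m (adTransportW φ U) hε hR y x v
  exact norm_mulOp_Qtilde_sub_le_diagonal L m φ U hℓ' (by positivity) hc hA hχ hwin S' hS' Sinv hSinv lam

end BlockOps

end Literature.MathematicalPhysics.QuantumFieldTheory.Balaban1983to89.B9Eq3101ConjugationLettersChain

end
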